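import Summits.AtomisticToContinuum.Crystallization.Theorems.ChargedEnergyGapEdgeSpaceDeficitA
import HarnessLib

/-!
# NODE 74 «EdgeSpaceDeficit» (lens-3 g74) — part 2 of 3 (sequel of `…ChargedEnergyGapEdgeSpaceDeficitA`)

Split for the 400-line cap by the landing lane (hand-2 g36); the module docstring of part 1 (`…ChargedEnergyGapEdgeSpaceDeficitA`) describes the whole node.  Same namespace; all FQNs unchanged.
0 sorry; standard axioms.
-/

noncomputable section
open scoped Classical
open Literature.MathematicalPhysics.StatisticalMechanics Literature.Geometry.DiscreteGeometry
open Summit.AtomisticToContinuum.Crystallization.Theses.PricedLinkCensus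
open Summit.AtomisticToContinuum.Crystallization.Theorems.ChargedEnergyGapNegative

namespace Summit.AtomisticToContinuum.Crystallization.Theorems.ChargedEnergyGapChartDial

/-! ## §4 The pieces (Δ) and (Λ) and the deficit shell functional -/

section DefFunctional

variable (ϱχ : ℝ) {m : ℕ} (D : Fin m → Set E3) (σ : Fin m → Bool)

/-- The **DEFICIT SHELL FUNCTIONAL**: one sixth of the Lipschitz-box deficit of the octahedron `(y, z)`, summed over the motif sites `y` and their mid
partners `z` whose octahedron is a SHELL octahedron (clean, not a plateau) — the field-free twin of `octShellL`. -/
def octDefShellL (κ₂ r₁ r₂ τ : ℝ) (P : PeriodicConfiguration 3) (X : Set E3) (ϱ : ℝ) (C : Set E3) : ℝ :=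
  ∑ y ∈ P.motif, ∑ᶠ z : E3,
    if (z ∈ P.points ∧ r₁ < dist y z ∧ dist y z ≤ r₂) ∧ (OctClean P r₁ X y z ∧ ¬OctPlateau P r₁ (siteW ϱχ D σ X ϱ C) y z) then
      (1 / 6) * octDeficit κ₂ r₁ τ (siteW ϱχ D σ X ϱ C) P y z else 0

end DefFunctional

section Pieces

variable (cls : Set E3 → Prop) (s lam ℓ μ₀ τ ϱ b₀ r_S b₁ ϱχ r₁ r₂ : ℝ)

/-- ★ piece (Δ) [OCT-DICT-q](`κ₂; ρlo, ρhi`) · THE DICTIONARY: over the block with framed octahedra, on every CLEAN mid-pair octahedron the Volterra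
field's octahedron form is at least minus the Lipschitz-box deficit of its vertex weights.  WEAKER (a lemma: local exactness `β = δu` on the six
vertices (`volterraField_localExact_of_diam`, needs `3τ·2ρ < b₁`) + `SmallStrain` ⇒ `u ∈ OctLip` + `le_csSup` with §2's bound) · TRUE · **PROVED at the
designate** (§5 `octDictQ_designate`, floor `1/8 ≤ b₁`).  Why it might fail at other dials: `6τρhi ≥ b₁` (no local exactness) or unbounded weights. -/
def OctDictQ (κ₂ ρlo ρhi : ℝ) : Prop :=
  ∀ (P : PeriodicConfiguration 3) (C X : Set E3) (β₀ : E3 → E3 → E3) (k : ℕ) (S : Fin k → CutPiece)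
    (m : ℕ) (D : Fin m → Set E3) (σ : Fin m → Bool),
    IsSeparatedRef s P → IsLabelledRef lam ℓ P → cls P.points → IsForceFree P → IsSiteStressFree P → HarmStableModRot μ₀ P →
    IsInvariantSet P C → IsInvariantSet P X → IsGlobalCocycle P β₀ → IsSeamSystem b₀ r_S P S → IsQuantisedSeams b₁ S →
    SmallStrain τ P X (volterraField P S β₀) → (∀ i, IsInvariantSet P (D i)) → IsFramedOct P r₁ r₂ ρlo ρhi →
      ∀ y ∈ P.points, ∀ z ∈ P.points, r₁ < dist y z → dist y z ≤ r₂ → OctClean P r₁ X y z →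
        -octDeficit κ₂ r₁ τ (siteW ϱχ D σ X ϱ C) P y z ≤ octForm κ₂ r₁ (siteW ϱχ D σ X ϱ C) X (volterraField P S β₀) P y z

/-- ★★ piece (Λ) [OCT-DEFICIT-LEDGER](`κ₂; ρlo, ρhi; c_T, cχ`) · **THE FIELD-FREE DEFICIT LEDGER** — the residual crux of NODE 74: for every
reference of the class with framed octahedra and all invariant `C, X, D_i` (NINE binders: no field, cocycle, seams, quantisation or small strain),
the deficit shell functional is paid by the two shell currencies and the free excision currency,
`octDefShellL ≤ c_T·shellMassL + cχ·transMassL + c_H·pricedNearCountL` for SOME `c_H ≥ 0`.  STRONGER than (K₁ᴴ) (octahedron-wise worst case, fields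
decoupled: (Δ) ∧ (Λ) ⇒ (K₁ᴴ), §6) but in a strictly smaller language · UNDECIDED → TRUE-leaning AT THE EXACT SCALE `cls = IsCubicFccImage (a₀√2) (a₀√2)`
(worst tested global ratio `0.23`, margin `≈ 4.5`: slabs in six orientations, point/line/two-core unions, χ-folds, capped gaps, doubly-laminar products;
`num/foldglobal.py, foldgeo.py, chifold.py, lamridge.py, rhowindow.py`) and FALSE over the window class of part C (ratio `4.0` at `a = 0.9605`:
scale-critical through `κ₂ − |c(2ρ)|`) · INSTRUMENTABLE (MEMO-g74 §5: COLUMN-74, PRODUCT-74) · ATTACKABLE-L (door [COLUMN]: transport of the budget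
along distance-gradient lines; support leaf [A0⁺] `0.970 ≤ a₀√2`).  Why it might fail: an invariant closed `C` (or `D_i`) whose cut locus meets the
onset shell `δ′ ∈ [20, 40]` of a void on a set of octahedra denser than `≈ 4×` the [001] hole-layer comb, with the lending transition columns excised
but unpriced — no such geometry is known (excision near the shell is priced by `c_H`). -/
def OctDefLedgerQ (κ₂ ρlo ρhi c_T cχ : ℝ) : Prop :=
  ∃ c_H : ℝ, 0 ≤ c_H ∧ ∀ (P : PeriodicConfiguration 3) (C X : Set E3) (m : ℕ) (D : Fin m → Set E3) (σ : Fin m → Bool),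
    IsSeparatedRef s P → IsLabelledRef lam ℓ P → cls P.points → IsForceFree P → IsSiteStressFree P →
    IsInvariantSet P C → IsInvariantSet P X → (∀ i, IsInvariantSet P (D i)) → IsFramedOct P r₁ r₂ ρlo ρhi →
      octDefShellL ϱχ D σ κ₂ r₁ r₂ τ P X ϱ C ≤
        c_T * shellMassL ϱχ D σ P X ϱ C + cχ * transMassL ϱχ D σ P X ϱ C + c_H * (pricedNearCountL ϱχ D σ P X ϱ C : ℝ)

end Pieces

/-! ## §5 ★ (Δ) PROVED at the designate -/

section DictProof

variable {P : PeriodicConfiguration 3}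

/-- On a clean octahedron, the form of a field that is a coboundary `δu` ON THE OCTAHEDRON equals the form of `δu` with empty excision. -/
theorem octForm_eq_cob {κ₂ r₁ : ℝ} {W : E3 → ℝ} {X : Set E3} {β : E3 → E3 → E3} {u : E3 → E3} {y z : E3}
    (hclean : OctClean P r₁ X y z) (hu : ∀ p, InOct P r₁ y z p → ∀ q, InOct P r₁ y z q → β p q = u q - u p) :
    octForm κ₂ r₁ W X β P y z = octForm κ₂ r₁ W ∅ (fun p q => u q - u p) P y z := by
  unfold octForm
  refine finsum_congr fun p => finsum_congr fun q => ?_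
  split_ifs with h
  · unfold octPairTerm pairElong
    rw [hu p h.1 q h.2]
    have hqX : q ∉ X := hclean q h.2
    simp only [hqX, not_false_eq_true, and_true, Set.mem_empty_iff_false]
  · rfl

/-- ★★ **(Δ) PROVED** at the designate `s = 3/5, τ = 3/100, r₁ = 6/5, r₂ = 3/2, κ₂ = ½, ρ ∈ [0.679, 0.691]`, any class, floor `1/8 ≤ b₁`:
local exactness on the six vertices (`3τ·2ρ ≤ 0.1244 < 1/8 ≤ b₁`), `SmallStrain` makes the potential admissible, `le_csSup`. -/
theorem octDictQ_designate (cls : Set E3 → Prop) (lam ℓ μ₀ ϱ b₀ r_S ϱχ : ℝ) {b₁ : ℝ} (hb : 1 / 8 ≤ b₁) :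
    OctDictQ cls (3 / 5) lam ℓ μ₀ (3 / 100) ϱ b₀ r_S b₁ ϱχ (6 / 5) (3 / 2) (1 / 2) (679 / 1000) (691 / 1000) := by
  intro P C X β₀ k S m D σ h1 h2 hcl h3 h4 h5 h6 h7 h8 h9 hq h10 h11 hFr y hy z hz hr1 hr2 hclean
  obtain ⟨c, f, ρ, hf, hρ1, hρ2, hy', hz', hO⟩ := hFr y hy z hz hr1 hr2
  have hρ : 0 < ρ := by linarith
  -- local exactness on the six vertices
  obtain ⟨u, hu⟩ := volterraField_localExact_of_diam (X := X) h8 hq h10 (by norm_num) (δ := 2 * ρ) (by linarith)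
    (K := {x | InOct P (6 / 5) y z x}) (fun x hx => hx.1) (fun x hx => hclean x hx)
    (fun p hp q hq' => by
      obtain ⟨i, b, rfl⟩ := (hO p).1 hp
      obtain ⟨j, b', rfl⟩ := (hO q).1 hq'
      exact dist_octVertex_le hf hρ.le i j b b')
  -- the potential is admissible
  have hlip : OctLip P (6 / 5) (3 / 100) y z u := by
    intro p q hp hq'
    rw [← hu p hp q hq']
    exact h10 p hp.1 q hq'.1 (hclean p hp) (hclean q hq')
  rw [octForm_eq_cob hclean hu]
  have key := neg_octForm_cob_le_octDeficit h1 (W := siteW ϱχ D σ X ϱ C) (fun x => siteW_nonneg X ϱ C x)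
    (fun x => siteW_le_one ϱχ D σ X ϱ C x) hr2 hlip
  linarith

end DictProof

/-! ## §6 The glue (L) ∧ (Δ) ∧ (Λ) ⟹ (K₁ᴴ) and the cone -/

section Glue

variable {cls : Set E3 → Prop} {lam ℓ μ₀ τ ϱ b₀ r_S b₁ ϱχ r₁ r₂ κ₂ ρlo ρhi c_T cχ : ℝ}

/-- ★★ **THE GLUE OF NODE 74**: (L) ∧ (Δ) ∧ (Λ) ⟹ (K₁ᴴ) over the same class (separation `3/5`, all other dials free): sum the dictionary termwise
along the shell selector; (Λ)'s excision constant is (K₁ᴴ)'s. -/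
theorem octShellHQ_of_dictLedger
    (hL : OctLedgerQ cls (3 / 5) lam ℓ μ₀ τ ϱ b₀ r_S b₁ ϱχ r₁ r₂ κ₂ ρlo ρhi)
    (hΔ : OctDictQ cls (3 / 5) lam ℓ μ₀ τ ϱ b₀ r_S b₁ ϱχ r₁ r₂ κ₂ ρlo ρhi)
    (hΛ : OctDefLedgerQ cls (3 / 5) lam ℓ τ ϱ ϱχ r₁ r₂ κ₂ ρlo ρhi c_T cχ) :
    OctShellHQ cls (3 / 5) lam ℓ μ₀ τ ϱ b₀ r_S b₁ ϱχ r₁ r₂ κ₂ c_T cχ := by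
  classical
  obtain ⟨c_H, hc, hΛ⟩ := hΛ
  refine ⟨c_H, hc, fun P C X β₀ k S m D σ h1 h2 hcl h3 h4 h5 h6 h7 h8 h9 hq h10 h11 => ?_⟩
  obtain ⟨hFr, -⟩ := hL P C X β₀ k S m D σ h1 h2 hcl h3 h4 h5 h6 h7 h8 h9 hq h10 h11
  have eΛ := hΛ P C X m D σ h1 h2 hcl h3 h4 h6 h7 h11 hFr
  have eΔ := hΔ P C X β₀ k S m D σ h1 h2 hcl h3 h4 h5 h6 h7 h8 h9 hq h10 h11 hFr
  -- −octDefShellL ≤ octShellL, termwise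
  have hcmp : -octDefShellL ϱχ D σ κ₂ r₁ r₂ τ P X ϱ C ≤ octShellL ϱχ D σ κ₂ r₁ r₂ (volterraField P S β₀) P X ϱ C := by
    unfold octDefShellL octShellL octSiteWith
    rw [← Finset.sum_neg_distrib]
    refine Finset.sum_le_sum fun y hy => ?_
    have hyP : y ∈ P.points := P.mem_points_of_mem_motif hy
    -- both finsums over `z` are finite sums over the sites in the closed ball of radius `r₂` about `y`
    have hF := h1.finite_inter_closedBall (by norm_num) y r₂
    set T : Finset E3 := hF.toFinset with hT
    have hmemT : ∀ z, z ∈ P.points → dist y z ≤ r₂ → z ∈ T := fun z hz hd => by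
      rw [hT, Set.Finite.mem_toFinset]
      exact ⟨hz, Metric.mem_closedBall.2 (by rw [dist_comm]; exact hd)⟩
    rw [finsum_eq_sum_of_support_subset (s := T), finsum_eq_sum_of_support_subset (s := T)]
    · rw [← Finset.sum_neg_distrib]
      refine Finset.sum_le_sum fun z _ => ?_
      split_ifs with h
      · have := eΔ y hyP z h.1.1 h.1.2.1 h.1.2.2 h.2.1; linarith
      · simp
    · intro z hz
      by_contra hzT
      exact (Function.mem_support.1 hz) (if_neg fun h' => hzT (hmemT z h'.1.1 h'.1.2.2))
    · intro z hz
      by_contra hzT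
      exact (Function.mem_support.1 hz) (if_neg fun h' => hzT (hmemT z h'.1.1 h'.1.2.2))
  linarith

/-- ★★★ **THE q-DESIGNATE THROUGH THE EDGE-SPACE DEFICIT**: part E's cone `chargedEnergyGap_of_octahedralLedgerH_numerics` with its leaf (K₁ᴴ)
`hOSH` replaced by the FIELD-FREE DEFICIT LEDGER (Λ) `hΛ` over the EXACT class `IsCubicFccImage (a₀√2) (a₀√2)` — (Δ) proved (§5), (G) at the exact
scale from `Fcc.FccScaleNumerics` (§1), (L) kept verbatim over the window class and transported (§1), (K₀) (part B) and (C) (part D) proved; every other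
leaf verbatim. -/
theorem chargedEnergyGap_of_edgeSpaceDeficit_numerics {b₁ : ℝ} (hb : 1 / 8 ≤ b₁) (hU : Fcc.FccScaleNumerics) (hF : ChargeRecount)
    (hIP : ImprovablePricingG (3 / 20) (1 / 10) (6 / 5) 10 (1 / 100) (3 / 5))
    (hFCP : FrustratedCorePricingG (3 / 20) (1 / 10) (6 / 5) 10 (1 / 100) 40 (3 / 5))
    (hCCP : CoherentCorePricingG (3 / 20) (1 / 10) (6 / 5) 10 (1 / 100) 40 (1 / 10) 40 (3 / 5))
    (hB : CoreBallRegularPricingW (maxCoverWeights (3 / 20) (1 / 10) (6 / 5) 10 (1 / 100) 40 (1 / 10) 40 160) (1 / 20) (3 / 5) 10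
      fun _ _ => True)
    (hLab : CleanLabellingW (maxCoverWeights (3 / 20) (1 / 10) (6 / 5) 10 (1 / 100) 40 (1 / 10) 40 160) (3 / 5) 10 (1 / 3) 3)
    (hSB : ShellBudgetW (maxCoverWeights (3 / 20) (1 / 10) (6 / 5) 10 (1 / 100) 40 (1 / 10) 40 160) (3 / 5) 100000)
    (hLf : LoadBoundQ IsFccImage (3 / 5) (1 / 3) 3 (1 / 100) (3 / 100) 160 (2 / 5) 3 b₁ 80 (6 / 5) (3 / 4) (3 / 10000000) (9 / 1000000))
    (hNf : NnStiffCls IsFccImage (27 / 10) (6 / 5))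
    (hOL : OctLedgerQ (IsCubicFccImage (1921 / 2000) (977 / 1000)) (3 / 5) (1 / 3) 3 (1 / 100) (3 / 100) 160 (2 / 5) 3 b₁ 80 (6 / 5) (3 / 2)
      (1 / 2) (679 / 1000) (691 / 1000))
    (hΛ : OctDefLedgerQ (IsCubicFccImage (Fcc.a0 * Real.sqrt 2) (Fcc.a0 * Real.sqrt 2)) (3 / 5) (1 / 3) 3 (3 / 100) 160 80 (6 / 5) (3 / 2)
      (1 / 2) (679 / 1000) (691 / 1000) (1 / 60000000) (1 / 2000000))
    (hFf : FarTrussQ IsFccImage (3 / 5) (1 / 3) 3 (1 / 100) (3 / 100) 160 (2 / 5) 3 b₁ 80 (6 / 5) (3 / 2) (11 / 20) (1 / 25) (1 / 60000000)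
      (1 / 2000000))
    (hGf : GeoExchQ IsFccImage (3 / 5) (1 / 3) 3 (1 / 100) (3 / 100) 160 (2 / 5) 3 b₁ 80 (6 / 5) (3 / 20) (1 / 25) (1 / 30000000) (1 / 1000000))
    (hLh : LoadBoundQ IsHcpImage (3 / 5) (1 / 3) 3 (1 / 100) (3 / 100) 160 (2 / 5) 3 b₁ 80 (6 / 5) (3 / 4) (3 / 10000000) (9 / 1000000))
    (hNh : NnStiffCls IsHcpImage (27 / 10) (6 / 5))
    (hMh : MidTrussQ IsHcpImage (3 / 5) (1 / 3) 3 (1 / 100) (3 / 100) 160 (2 / 5) 3 b₁ 80 (6 / 5) (3 / 2) (1 / 2) 0 (1 / 60000000) (1 / 2000000))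
    (hFh : FarTrussQ IsHcpImage (3 / 5) (1 / 3) 3 (1 / 100) (3 / 100) 160 (2 / 5) 3 b₁ 80 (6 / 5) (3 / 2) (1 / 2) (1 / 40) (1 / 60000000)
      (1 / 2000000))
    (hGh : GeoExchQ IsHcpImage (3 / 5) (1 / 3) 3 (1 / 100) (3 / 100) 160 (2 / 5) 3 b₁ 80 (6 / 5) (1 / 5) (1 / 40) (1 / 30000000) (1 / 1000000))
    (hN : LocalSeamReductionQ (3 / 5) (1 / 3) 3 (1 / 100) (3 / 100) (1 / 2) 160 (2 / 5) 3 b₁ 80 (1 / 3000000) (1 / 100000)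
      (maxCoverWeights (3 / 20) (1 / 10) (6 / 5) 10 (1 / 100) 40 (1 / 10) 40 160) (1 / 20) 10 100000)
    (hP : ChartedChargePricingG (3 / 20) (1 / 10) (3 / 5)) : ChargedEnergyGap :=
  chargedEnergyGap_of_quantisedCascade_designate hF hIP hFCP hCCP hB hLab hSB hLf hNf
    (midTrussQ_of_octahedralLedgerH (cubicSelectExact_of_numerics hU) (octLedgerQ_exact_of_window hOL)
      (octPlateauQ_designate _ _ _ _ _ _ _ _ _ hb)
      (octShellHQ_of_dictLedger (octLedgerQ_exact_of_window hOL) (octDictQ_designate _ _ _ _ _ _ _ _ hb) hΛ)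
      (octCollarQ_designate _ _ _ _ _ _ _ _))
    hFf hGf hLh hNh hMh hFh hGh hN hP

end Glue

end Summit.AtomisticToContinuum.Crystallization.Theorems.ChargedEnergyGapChartDial
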